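import Mathlib
import Summits.Ventures.DiscreteObjects.Mahler.GraeffeIdentity
import Summits.Ventures.DiscreteObjects.Mahler.Height1CellSymmetry
import Summits.Ventures.DiscreteObjects.Mahler.MRWDegree8Measure
import Summits.Ventures.DiscreteObjects.Mahler.CensusData10to18

/-!
# The imprimitive degree-16 census entries are lifts of the degree-8 minimiser (venture `DiscreteObjects`, target L)

Cell `pub-namedobj`, seat `pub-namedobj-mahler` (gen 11). Framing: lottery ticket; floor = certified
bounds/negative ranges.

The two imprimitive entries of the degree-16 census row (`CensusData10to18.coresDeg16`, "listed last") are
`c16_15 = x¹⁶ - x¹⁰ - x⁸ - x⁶ + 1 = mrwPoly8(-x²)` and `c16_16 = x¹⁶ + x¹⁰ - x⁸ + x⁶ + 1 = mrwPoly8(x²)`, where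
`mrwPoly8 = x⁸ + x⁵ - x⁴ + x³ + 1` is the MRW08 Table 1 minimiser of degree 8.  Since `M(P(x²)) = M(P)` and
`M(P(-x)) = M(P)`, both have the measure of `mrwPoly8`, kernel-certified in `MRWDegree8Measure`
(`1.28063815 < M < 1.28063816`); this closes the kernel certification of the degree-16 row (the 14 primitive cores are
certified in `CensusDeg1618Salem`, `CensusDeg16Nu2A/B`, `CensusDeg16TwoPairs`; `c16_16` also independently in
`CensusDeg16Nu2B`).
-/

namespace Summit.Ventures.DiscreteObjects.Mahler

open Polynomial Literature.NumberTheory.MahlerMeasure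

/-- `c16_15 = mrwPoly8(-x²)`. -/
theorem ofCoeffs_c16_15_eq : ofCoeffs c16_15 = (mrwPoly8.comp (-X)).comp (X ^ 2) := by
  unfold ofCoeffs c16_15
  simp [List.zipIdx, mrwPoly8]
  ring

/-- `c16_16 = mrwPoly8(x²)`. -/
theorem ofCoeffs_c16_16_eq : ofCoeffs c16_16 = mrwPoly8.comp (X ^ 2) := by
  unfold ofCoeffs c16_16
  simp [List.zipIdx, mrwPoly8]
  ring

/-- **`1.28063815 < M(c16_15) < 1.28063816`**: `M(c16_15) = M(mrwPoly8)`. -/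
theorem c16_15_measure_enclosure :
    (128063815 / 10 ^ 8 : ℝ) < intMahlerMeasure (ofCoeffs c16_15) ∧
      intMahlerMeasure (ofCoeffs c16_15) < 128063816 / 10 ^ 8 := by
  rw [ofCoeffs_c16_15_eq, intMahlerMeasure_comp_X_pow_two, intMahlerMeasure_comp_neg_X]
  exact mrwPoly8_measure_enclosure

/-- `M(c16_16) = M(mrwPoly8)` (second route to `c16_16_measure_enclosure` of `CensusDeg16Nu2B`). -/
theorem c16_16_measure_eq_mrwPoly8 : intMahlerMeasure (ofCoeffs c16_16) = intMahlerMeasure mrwPoly8 := by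
  rw [ofCoeffs_c16_16_eq, intMahlerMeasure_comp_X_pow_two]

end Summit.Ventures.DiscreteObjects.Mahler
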